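import Summits.QuantumFields.YangMills.Theorems.BalabanLadderROTTiltBoundaryDecay
import HarnessLib

/-!
# Crux `ROT` (stmt-QuantumFields-20042): the tilt split is LOSSLESS given the tilt half — N-ROT.3 ⟺ King's lattice Ward statement on the class

Helper file of the fleet lead `ym-spine-20042-p1` (generation g4), `--supports stmt-QuantumFields-20042` (count-neutral).

`Theorems/BalabanLadderROTTiltSplit.lean` (p469977) proves `TiltedRegComparisonOn ∧ TiltInsensitivityOn ⇒ LatticeKingWardOn {θ}` (the split of
King's finite-angle defect into a regularisation bracket and a tilt bracket).  Here the converse direction given the tilt half: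
`TiltInsensitivityOn ∧ LatticeKingWardOn {θ} ⇒ TiltedRegComparisonOn` (`tiltedRegComparisonOn_of_latticeKingWardOn`; same exact identity
`kingDefect_eq_brackets`, read at `R⁻¹·F`, King's class being stable under `R⁻¹`), hence the equivalence
`tiltedRegComparisonOn_iff_latticeKingWardOn` under `TiltInsensitivityOn`, and — with the tilt half supplied by the boundary-decay input
(`tiltInsensitivityOn_of_boundaryDecay`, p484693) — `tiltedRegComparisonOn_iff_latticeKingWardOn_of_boundaryDecay`.

READING (census): modulo the infrared input «boundary-influence decay in units a», the remaining half N-ROT.3 of the split on a tilt cell is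
EXACTLY King's single-angle lattice Ward statement on the fitted class — the split neither loses nor gains; what is open is King's comparison
itself (leg 1, XL).  No definition, no sorry.
-/

set_option autoImplicit false

noncomputable section

open scoped SchwartzMap
open MeasureTheory Filter Topology
open Literature.MathematicalPhysics.QuantumFieldTheory Literature.MathematicalPhysics.QuantumLattice
open Literature.MathematicalPhysics.AQFT
open Summit.QuantumFields.YangMills.Cruxes.OSLegsFromFemtoAndGap.DlrCollarTransfer
open Summit.QuantumFields.YangMills.Cruxes.OSLegsAtWeakCouplingC.Sketch
open Summit.QuantumFields.YangMills.Cruxes.OSLegsAtWeakCouplingC.Y2Bridge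
open Summit.QuantumFields.YangMills.Theorems.OSLegsFromFemtoAndGap (latticeDist)
open Summit.QuantumFields.YangMills.Theorems.NPointIsotropy.Negative (E4)

namespace Summit.QuantumFields.YangMills.Theorems.ROT

section Converse

variable {G : Type} [Group G] [TopologicalSpace G] [IsTopologicalGroup G] [CompactSpace G]
  [MeasurableSpace G] [BorelSpace G]

/-- **`TiltInsensitivityOn ∧ LatticeKingWardOn {θ} ⇒ TiltedRegComparisonOn`**: the regularisation bracket at `F` is King's defect at `R⁻¹·F`
minus the tilt bracket at `R⁻¹·F` (`kingDefect_eq_brackets` read at `R⁻¹·F`, `R·(R⁻¹·F) = F`), and King's class is stable under `R⁻¹`. -/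
theorem tiltedRegComparisonOn_of_latticeKingWardOn (r : LatticeRep G) (a : ℝ → ℝ) (C : ℕ → PeriodCell 4) (θ : ℝ) (S : Set ℕ)
    (hTI : TiltInsensitivityOn G r a C S) (hK : LatticeKingWardOn G r a ({θ} : Set ℝ) S) :
    TiltedRegComparisonOn G r a C θ S := by
  intro sch hS hunits hβ hranges
  obtain ⟨r₁, hr₁, h1⟩ := hK sch hS hunits hβ hranges
  obtain ⟨r₂, hr₂, h2⟩ := hTI sch hS hunits hβ hranges
  refine ⟨min r₁ r₂, lt_min hr₁ hr₂, fun n hn F hF => ?_⟩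
  set F' : 𝓢((Fin n → E4), ℂ) := linActMulti (planeRot (0 : Fin 3) θ).symm F with hF'
  have hF'₁ : F' ∈ King.KingClass n r₁ :=
    King.linActMulti_mem_kingClass (kingClass_mono (min_le_left _ _) hF) (planeRot (0 : Fin 3) θ).symm
  have hF'₂ : F' ∈ King.KingClass n r₂ :=
    King.linActMulti_mem_kingClass (kingClass_mono (min_le_right _ _) hF) (planeRot (0 : Fin 3) θ).symm
  have hRF' : linActMulti (planeRot (0 : Fin 3) θ) F' = F := linActMulti_linActMulti_symm _ F
  have t1 := h1 n hn F' hF'₁ θ (Set.mem_singleton θ)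
  have t2 := h2 n hn F' hF'₂
  have t12 := t1.sub t2
  rw [sub_zero] at t12
  refine t12.congr fun k => ?_
  have e := kingDefect_eq_brackets (C (sch.L k)) r (sch.β k) (sch.L k) (sch.a k) θ F'
  rw [hRF'] at e ⊢
  linear_combination e

/-- **Given the tilt half, the regularisation bracket and King's single-angle lattice Ward statement on the class are EQUIVALENT.** -/
theorem tiltedRegComparisonOn_iff_latticeKingWardOn (r : LatticeRep G) (a : ℝ → ℝ) (C : ℕ → PeriodCell 4) (θ : ℝ) (S : Set ℕ)
    (hTI : TiltInsensitivityOn G r a C S) :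
    TiltedRegComparisonOn G r a C θ S ↔ LatticeKingWardOn G r a ({θ} : Set ℝ) S :=
  ⟨fun h => latticeKingWardOn_of_tilt r a C θ S h hTI, tiltedRegComparisonOn_of_latticeKingWardOn r a C θ S hTI⟩

open PythTriple

/-- **Modulo boundary-influence decay in units `a`, N-ROT.3 on a tilt cell IS King's single-angle lattice Ward statement on the fitted class**
(any Pythagorean triple `t`, any angle `θ`): the split `KingOnClass ⇐ NROT3 ∧ TI` of p469977 is lossless once its tilt half is supplied by
`tiltInsensitivityOn_of_boundaryDecay`. -/
theorem tiltedRegComparisonOn_iff_latticeKingWardOn_of_boundaryDecay (t : PythTriple) (r : LatticeRep G) (a : ℝ → ℝ) (θ : ℝ)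
    (hdecay : ∃ (c₆ β₆ K₆ : ℝ), 0 < c₆ ∧ ∀ β : ℝ, β₆ ≤ β →
      ∀ (c : Fin 4 → ℤ) (b d : ℕ) (η η' : LGConfig 4 G) (A : LGConfig 4 G → ℝ) (M : ℝ)
        (S : Finset (Literature.MathematicalPhysics.QuantumLattice.ZdEdge 4)),
        Continuous A → (∀ U, |A U| ≤ M) → IsCylinder A S → (∀ e ∈ S, d ≤ depth c b e.1) →
        |kerE G r β c b η A - kerE G r β c b η' A| ≤ K₆ * M * (b : ℝ) ^ 4 * Real.exp (-(c₆ * a β * d))) :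
    TiltedRegComparisonOn G r a t.tiltCell θ (fittedClass t.q) ↔ LatticeKingWardOn G r a ({θ} : Set ℝ) (fittedClass t.q) :=
  tiltedRegComparisonOn_iff_latticeKingWardOn r a t.tiltCell θ (fittedClass t.q)
    (tiltInsensitivityOn_of_boundaryDecay t r a hdecay)

end Converse

end Summit.QuantumFields.YangMills.Theorems.ROT

end
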